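import Mathlib.Analysis.InnerProductSpace.Basic
import HarnessLib

/-!
# NE7StencilForms — SUMS OF SQUARES OF COMMUTING STENCILS ON A FINITE ABELIAN GROUP: actions, convolution, commutation, product forms, and the TENSOR INEQUALITY
# `A ≤ g·B ∧ A′ ≤ g′·B′ ⇒ A⊗A′ ≤ g·g′·B⊗B′` — the direction-by-direction assembly engine of the composite letter (C)
# (lineage `b2b-balaban-t4-ne7b-p1`, gen 162; route (H′), memo `t4/b2b-balaban-t4-ne7b-p1/g162/records/SCOPING-LEVELMASSES.md` §11, file (R3c-core))

Cell `pub-balaban`, rung (B)+1 sub-cell t4, lineage `b2b-balaban-t4-ne7b-p1` (row NE7b OWNER + CRUX PROVER; junction service for row NE7 on ROAD-G116 §6 (G3)), generation 162.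
WHY.  ✓ `NE7LyapunovStencil1D` proves, on EVERY finite abelian group `Γ` with EVERY step `e`, the one-direction Lyapunov inequalities `A_e(v) ≤ g·L·B_e(v)` of the exact Whitney lift's
flat and tent factors, where `A`, `B` are SUMS OF SQUARES OF STENCILS (finite linear combinations of translates).  On the coarse torus `Γ = (ℤ∕N)^d` the directions are the steps
`e_μ`, so the 1-D lemmas already hold in every direction of every dimension; the `d`-dimensional Lyapunov form of the lift's main part `W∘B_c⁻¹ = L⁻¹⊗_μ(I_μ∘b_μ⁻¹)` is the
PRODUCT of the one-direction forms, and the assembly of (C) is the abstract fact proved here: products of sums-of-squares forms of COMMUTING stencils preserve inequalities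
(memo §11, (R3c)).  No Fourier analysis: stencils on an abelian group commute, and a product form evaluated at `v` is a positive combination of the factor form evaluated at
translates-combinations of `v`.
WHAT ([folklore]; DATA defs `act`, `conv`, `formEval`, `formProd`; 0 sorry; `Γ` any finite abelian group, `X` any real inner product space):
§1 stencils `s : κ → ℝ × Γ` acting by `act s v y = Σ_k c_k • v (y + a_k)`; `act_add`, `act_smul`, `act_shift`; convolution `conv s t` on `κ × κ'` with **`act_conv`** (`act (conv s t) = act s ∘ act t`)
   and **`act_comm`** (stencils commute);
§2 forms `F : ι → ℝ × (κ → ℝ × Γ)` evaluated by `formEval F v = Σ_i c_i · Σ_y ‖act s_i v y‖²`; product `formProd F F'` on `ι × ι'` with stencils `conv s_i s'_{i'}`; **`formEval_prod_left`** ∕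
   **`formEval_prod_right`** (`(F⊗F')(v) = Σ_{i'} c'_{i'}·F(act s'_{i'} v) = Σ_i c_i·F'(act s_i v)`);
§3 **`formProd_le`** — THE TENSOR INEQUALITY: if `F(v) ≤ g·B(v)` and `F'(v) ≤ g'·B'(v)` for all `v`, with the coefficients of `F'` and of `B` nonnegative and `g ≥ 0`, then
   `(F⊗F')(v) ≤ g·g'·(B⊗B')(v)` for all `v`; `formEval_nonneg`, `formEval_mono_const`.
WHAT IS NOT HERE: the instantiation (the flat∕tent forms of ✓ `NE7LyapunovStencil1D` as `formEval`s, the `d`-fold product, the identification with the lift on the refined lattice — files (R3b∕c)).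
HONEST FRAMING (page 1): elementary algebra of OUR bookkeeping objects; nothing of Bałaban's asserted; NOT (C), NOT (G3), NOT (G), NOT NE7∕NE3 as spine nodes; row NE7b NOT PRINTED ∕ NOT PROVED; spine 0∕9;
finite T⁴ rung (B)+1 — NOT infinite volume, NOT mass gap, NOT BetaPertH, NOT Clay.
-/

set_option autoImplicit false

open scoped BigOperators RealInnerProductSpace
open Finset

namespace Summit.QuantumFields.BalabanUV.T4Continuum.NE7StencilForms

variable {Γ : Type*} [AddCommGroup Γ] [Fintype Γ]
variable {X : Type*} [NormedAddCommGroup X] [InnerProductSpace ℝ X]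

/-! ## §1 Stencils: action, convolution, commutation -/

/-- **THE ACTION OF A STENCIL** `s : κ → ℝ × Γ` (coefficients and shifts) on a field: `act s v y = Σ_k (s k).1 • v (y + (s k).2)`. [folklore] -/
def act {κ : Type*} [Fintype κ] (s : κ → ℝ × Γ) (v : Γ → X) : Γ → X := fun y => ∑ k, (s k).1 • v (y + (s k).2)

/-- **CONVOLUTION OF STENCILS**: `conv s t (k, k') = (c_k·c'_{k'}, a_k + a'_{k'})`. [folklore] -/
def conv {κ κ' : Type*} (s : κ → ℝ × Γ) (t : κ' → ℝ × Γ) : κ × κ' → ℝ × Γ := fun p => ((s p.1).1 * (t p.2).1, (s p.1).2 + (t p.2).2)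

section Stencil

variable {κ κ' : Type*} [Fintype κ] [Fintype κ']

omit [Fintype Γ] in
/-- The action is additive in the field. [folklore] -/
theorem act_add (s : κ → ℝ × Γ) (v w : Γ → X) : act s (fun y => v y + w y) = fun y => act s v y + act s w y := by
  funext y; simp only [act, smul_add, Finset.sum_add_distrib]

omit [Fintype Γ] in
/-- The action is real-homogeneous in the field. [folklore] -/
theorem act_smul (s : κ → ℝ × Γ) (t : ℝ) (v : Γ → X) : act s (fun y => t • v y) = fun y => t • act s v y := by
  funext y; simp only [act, Finset.smul_sum, smul_comm t]

omit [Fintype Γ] in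
/-- The action commutes with translations. [folklore] -/
theorem act_shift (s : κ → ℝ × Γ) (v : Γ → X) (a : Γ) : act s (fun y => v (y + a)) = fun y => act s v (y + a) := by
  funext y; simp only [act, add_right_comm]

omit [Fintype Γ] in
/-- **`act (conv s t) = act s ∘ act t`**. [folklore] -/
theorem act_conv (s : κ → ℝ × Γ) (t : κ' → ℝ × Γ) (v : Γ → X) : act (conv s t) v = act s (act t v) := by
  funext y
  simp only [act, conv, Finset.smul_sum, smul_smul, Fintype.sum_prod_type, add_assoc]

omit [Fintype Γ] in
/-- Convolution is commutative up to the swap of indices. [folklore] -/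
theorem act_conv_swap (s : κ → ℝ × Γ) (t : κ' → ℝ × Γ) (v : Γ → X) : act (conv s t) v = act (conv t s) v := by
  funext y
  simp only [act, conv]
  rw [Fintype.sum_prod_type, Fintype.sum_prod_type_right]
  refine Finset.sum_congr rfl fun k _ => Finset.sum_congr rfl fun k' _ => ?_
  rw [mul_comm, add_comm (s k).2]

omit [Fintype Γ] in
/-- **STENCILS COMMUTE** (the group is abelian). [folklore] -/
theorem act_comm (s : κ → ℝ × Γ) (t : κ' → ℝ × Γ) (v : Γ → X) : act s (act t v) = act t (act s v) := by
  rw [← act_conv, act_conv_swap, act_conv]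

end Stencil

/-! ## §2 Sums-of-squares forms and their products -/

/-- **A SUM-OF-SQUARES FORM** `F : ι → ℝ × (κ → ℝ × Γ)` evaluated at a field: `formEval F v = Σ_i (F i).1 · Σ_y ‖act (F i).2 v y‖²`. [folklore] -/
def formEval {ι κ : Type*} [Fintype ι] [Fintype κ] (F : ι → ℝ × (κ → ℝ × Γ)) (v : Γ → X) : ℝ :=
  ∑ i, (F i).1 * ∑ y, ‖act (F i).2 v y‖ ^ 2

/-- **THE PRODUCT OF TWO FORMS**: indices `ι × ι'`, coefficients multiplied, stencils convolved. [folklore] -/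
def formProd {ι ι' κ κ' : Type*} (F : ι → ℝ × (κ → ℝ × Γ)) (F' : ι' → ℝ × (κ' → ℝ × Γ)) : ι × ι' → ℝ × (κ × κ' → ℝ × Γ) :=
  fun p => ((F p.1).1 * (F' p.2).1, conv (F p.1).2 (F' p.2).2)

section Forms

variable {ι ι' κ κ' : Type*} [Fintype ι] [Fintype ι'] [Fintype κ] [Fintype κ']

/-- A form with nonnegative coefficients is nonnegative. [folklore] -/
theorem formEval_nonneg (F : ι → ℝ × (κ → ℝ × Γ)) (hF : ∀ i, 0 ≤ (F i).1) (v : Γ → X) : 0 ≤ formEval F v :=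
  Finset.sum_nonneg fun i _ => mul_nonneg (hF i) (Finset.sum_nonneg fun _ _ => by positivity)

/-- **PRODUCT FORM, EXPANDED ON THE RIGHT FACTOR**: `(F⊗F')(v) = Σ_{i'} c'_{i'} · F(act s'_{i'} v)`. [folklore] -/
theorem formEval_prod_right (F : ι → ℝ × (κ → ℝ × Γ)) (F' : ι' → ℝ × (κ' → ℝ × Γ)) (v : Γ → X) :
    formEval (formProd F F') v = ∑ i', (F' i').1 * formEval F (act (F' i').2 v) := by
  unfold formEval formProd
  rw [Fintype.sum_prod_type_right]
  refine Finset.sum_congr rfl fun i' _ => ?_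
  rw [Finset.mul_sum]
  refine Finset.sum_congr rfl fun i _ => ?_
  rw [act_conv]
  ring

/-- **PRODUCT FORM, EXPANDED ON THE LEFT FACTOR**: `(F⊗F')(v) = Σ_i c_i · F'(act s_i v)` (stencils commute). [folklore] -/
theorem formEval_prod_left (F : ι → ℝ × (κ → ℝ × Γ)) (F' : ι' → ℝ × (κ' → ℝ × Γ)) (v : Γ → X) :
    formEval (formProd F F') v = ∑ i, (F i).1 * formEval F' (act (F i).2 v) := by
  unfold formEval formProd
  rw [Fintype.sum_prod_type]
  refine Finset.sum_congr rfl fun i _ => ?_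
  rw [Finset.mul_sum]
  refine Finset.sum_congr rfl fun i' _ => ?_
  rw [act_conv, act_comm]
  ring

/-! ## §3 The tensor inequality -/

/-- **THE TENSOR INEQUALITY.**  If `F(v) ≤ g·B(v)` and `F'(v) ≤ g'·B'(v)` for every field `v`, the coefficients of `F'` and of `B` are nonnegative and `g ≥ 0`, then
`(F⊗F')(v) ≤ g·g'·(B⊗B')(v)` for every `v` — expand on the right factor, bound `F ≤ gB` at the translated fields, re-expand on the left factor of `B⊗F'`, bound `F' ≤ g'B'`. [folklore] -/
theorem formProd_le {ιB ιB' κB κB' : Type*} [Fintype ιB] [Fintype ιB'] [Fintype κB] [Fintype κB']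
    (F : ι → ℝ × (κ → ℝ × Γ)) (B : ιB → ℝ × (κB → ℝ × Γ)) (F' : ι' → ℝ × (κ' → ℝ × Γ)) (B' : ιB' → ℝ × (κB' → ℝ × Γ))
    {g g' : ℝ} (hg : 0 ≤ g) (hF' : ∀ i', 0 ≤ (F' i').1) (hB : ∀ j, 0 ≤ (B j).1)
    (h1 : ∀ v : Γ → X, formEval F v ≤ g * formEval B v) (h2 : ∀ v : Γ → X, formEval F' v ≤ g' * formEval B' v) :
    ∀ v : Γ → X, formEval (formProd F F') v ≤ g * g' * formEval (formProd B B') v := by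
  intro v
  -- Step 1: `F ⊗ F' ≤ g · (B ⊗ F')`, expanding on the right factor
  have step1 : formEval (formProd F F') v ≤ g * formEval (formProd B F') v := by
    rw [formEval_prod_right, formEval_prod_right, Finset.mul_sum]
    refine Finset.sum_le_sum fun i' _ => ?_
    have h := h1 (act (F' i').2 v)
    calc (F' i').1 * formEval F (act (F' i').2 v) ≤ (F' i').1 * (g * formEval B (act (F' i').2 v)) := mul_le_mul_of_nonneg_left h (hF' i')
      _ = g * ((F' i').1 * formEval B (act (F' i').2 v)) := by ring
  -- Step 2: `B ⊗ F' ≤ g' · (B ⊗ B')`, expanding on the left factor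
  have step2 : formEval (formProd B F') v ≤ g' * formEval (formProd B B') v := by
    rw [formEval_prod_left, formEval_prod_left, Finset.mul_sum]
    refine Finset.sum_le_sum fun j _ => ?_
    have h := h2 (act (B j).2 v)
    calc (B j).1 * formEval F' (act (B j).2 v) ≤ (B j).1 * (g' * formEval B' (act (B j).2 v)) := mul_le_mul_of_nonneg_left h (hB j)
      _ = g' * ((B j).1 * formEval B' (act (B j).2 v)) := by ring
  calc formEval (formProd F F') v ≤ g * formEval (formProd B F') v := step1
    _ ≤ g * (g' * formEval (formProd B B') v) := mul_le_mul_of_nonneg_left step2 hg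
    _ = g * g' * formEval (formProd B B') v := by ring

/-- Monotonicity in the constant. [folklore] -/
theorem formEval_mono_const (F : ι → ℝ × (κ → ℝ × Γ)) (B : ι' → ℝ × (κ' → ℝ × Γ)) (hB : ∀ j, 0 ≤ (B j).1) {g g' : ℝ} (hgg : g ≤ g')
    (h : ∀ v : Γ → X, formEval F v ≤ g * formEval B v) : ∀ v : Γ → X, formEval F v ≤ g' * formEval B v :=
  fun v => (h v).trans (mul_le_mul_of_nonneg_right hgg (formEval_nonneg B hB v))

/-- **PRECOMPOSITION**: an inequality of forms survives replacing the field by a stencil image (used to strip common factors). [folklore] -/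
theorem formLe_act (F : ι → ℝ × (κ → ℝ × Γ)) (B : ι' → ℝ × (κ' → ℝ × Γ)) {g : ℝ} (h : ∀ v : Γ → X, formEval F v ≤ g * formEval B v)
    {κ'' : Type*} [Fintype κ''] (t : κ'' → ℝ × Γ) : ∀ v : Γ → X, formEval F (act t v) ≤ g * formEval B (act t v) :=
  fun v => h (act t v)

end Forms

end Summit.QuantumFields.BalabanUV.T4Continuum.NE7StencilForms
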